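import Mathlib
import HarnessLib
import Summits.ResolutionOfSingularities.ResolutionOfSingularities.Theorems.HomologicalConductorPersistenceKC3FrobeniusOrder
import Summits.ResolutionOfSingularities.ResolutionOfSingularities.Theorems.HomologicalConductorPersistenceFrobeniusOrderLevel
import Literature.RingTheory.CohomologyAnnihilator.RegularRing
import Literature.RingTheory.CohomologyAnnihilator.Localization

/-!
# K-C3: `ca(W₀) = ca⁴(W₀)` for `W₀ = k[a,b,c]^{μ₆(1,2,3)}` — «all levels» in the kernel

Route `ResolutionOfSingularities/HomologicalConductor`, chain W4.4b, crux `Persistence`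
(stmt-ResolutionOfSingularities-16484), K-C3.  [OURS · L1 w44b · res-D-pv-037 gen 9; AI-written and
AI-reviewed only (weaker than expert review); NOT a statement of the manuscript under study.]

res-L1-w44b-tri-2's C3 verdict (2026-08-27T10:46:54Z) used «`W` Gorenstein of dimension 3 ⇒
`caⁿ(W) = ca⁴(W)` for every `n ≥ 4` (cosyzygies)».  Here this is a THEOREM: `W₀` is a free Frobenius
order over `P₀ = k[a⁶,b³,c²]` (`…KC3FrobeniusOrder.lean`), `P₀ ≅ k[A,B,C]` (`kc3θEquiv`) has
`ca⁴(P₀) = P₀` (Hilbert's syzygy theorem, tree `cohomologyAnnihilatorOfDegree_mvPolynomial_eq_top`), so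
`…FrobeniusOrderLevel.lean` applies:

* `cohomologyAnnihilatorOfDegree_four_kc3P_eq_top` — `ca⁴(P₀) = P₀`;
* **`cohomologyAnnihilator_kc3W_eq_degree_four`** — `ca(W₀) = ca⁴(W₀)` (and `caⁿ(W₀) = ca⁴(W₀)`, `n ≥ 4`);
* **`mem_cohomologyAnnihilator_kc3W_iff_forall_lattice`** — `x ∈ ca(W₀)` iff `x` stably annihilates
  every finitely generated `W₀`-module that is projective over `P₀` (the lattice / MCM category).
-/

noncomputable section

-- single-problem summit: the doubled namespace component `ResolutionOfSingularities` is forced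
set_option linter.dupNamespace false

open MvPolynomial CategoryTheory Literature.RingTheory.CohomologyAnnihilator
open Summit.ResolutionOfSingularities.ResolutionOfSingularities.Theorems.NoZeno.SandwichCluster

universe u

namespace Summit.ResolutionOfSingularities.ResolutionOfSingularities.Theorems.HomologicalConductor.KC3FrobeniusOrder

open Summit.ResolutionOfSingularities.ResolutionOfSingularities.Theorems.HomologicalConductor.FrobeniusOrderSyzygy

variable {k : Type u} [Field k]

/-- `P₀ = k[a⁶,b³,c²]` is a noetherian ring (isomorphic to `k[A,B,C]`). [folklore] -/
instance kc3P.isNoetherianRing : IsNoetherianRing ↥(kc3P k) :=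
  isNoetherianRing_of_ringEquiv (MvPolynomial (Fin 3) k) (kc3θEquiv k).toRingEquiv

/-- **`ca⁴(P₀) = P₀`**: Hilbert's syzygy theorem for `k[A,B,C]`, transported along `kc3θEquiv`.
[folklore] -/
theorem cohomologyAnnihilatorOfDegree_four_kc3P_eq_top :
    cohomologyAnnihilatorOfDegree ↥(kc3P k) 4 = ⊤ := by
  have h := map_ringEquiv_cohomologyAnnihilatorOfDegree (kc3θEquiv k).toRingEquiv (3 + 1)
  have h3 := cohomologyAnnihilatorOfDegree_mvPolynomial_eq_top k 3
  rw [h3, Ideal.map_top] at h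
  exact h.symm

/-- **`ca(W₀) = ca⁴(W₀)`** for `W₀ = k[a,b,c]^{μ₆(1,2,3)}`: the cohomology annihilator of the K-C3
arrival ring is reached at Ext-level `4 = dim + 1` (res-L1-w44b-tri-2's «all levels» argument, in the
kernel: Frobenius order over `k[a⁶,b³,c²]` + Hilbert syzygies). [OURS · L1 w44b] -/
theorem cohomologyAnnihilator_kc3W_eq_degree_four :
    cohomologyAnnihilator ↥(kc3W k) = cohomologyAnnihilatorOfDegree ↥(kc3W k) 4 :=
  cohomologyAnnihilator_eq_cohomologyAnnihilatorOfDegree_succ_basis (d := 3)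
    cohomologyAnnihilatorOfDegree_four_kc3P_eq_top (kc3Basis k) (kc3BasisDual k)
    kc3τ_basis_mul_basisDual

/-- `caⁿ(W₀) = ca⁴(W₀)` for every `n ≥ 4`. [OURS · L1 w44b] -/
theorem cohomologyAnnihilatorOfDegree_kc3W_eq_of_le {n : ℕ} (hn : 4 ≤ n) :
    cohomologyAnnihilatorOfDegree ↥(kc3W k) n = cohomologyAnnihilatorOfDegree ↥(kc3W k) 4 := by
  obtain ⟨h₁, h₂⟩ := dualBases_of_basis (τ := kc3τ k) (kc3Basis k) (kc3BasisDual k)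
    kc3τ_basis_mul_basisDual
  exact cohomologyAnnihilatorOfDegree_eq_of_le (d := 3) cohomologyAnnihilatorOfDegree_four_kc3P_eq_top
    h₁ h₂ hn

/-- **`x ∈ ca(W₀)` iff `x` stably annihilates every lattice** (finitely generated `W₀`-module projective
over `P₀ = k[a⁶,b³,c²]`). [OURS · L1 w44b] -/
theorem mem_cohomologyAnnihilator_kc3W_iff_forall_lattice {x : ↥(kc3W k)} :
    x ∈ cohomologyAnnihilator ↥(kc3W k) ↔
      ∀ (L : Type u) [AddCommGroup L] [Module ↥(kc3W k) L] [Module ↥(kc3P k) L]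
        [IsScalarTower ↥(kc3P k) ↥(kc3W k) L] [Module.Finite ↥(kc3W k) L]
        [Module.Projective ↥(kc3P k) L], StablyAnnihilates ↥(kc3W k) x (ModuleCat.of ↥(kc3W k) L) := by
  obtain ⟨h₁, h₂⟩ := dualBases_of_basis (τ := kc3τ k) (kc3Basis k) (kc3BasisDual k)
    kc3τ_basis_mul_basisDual
  exact mem_cohomologyAnnihilator_iff_forall_lattice (d := 3)
    cohomologyAnnihilatorOfDegree_four_kc3P_eq_top h₁ h₂

end Summit.ResolutionOfSingularities.ResolutionOfSingularities.Theorems.HomologicalConductor.KC3FrobeniusOrder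

end
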